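import Summits.QuantumFields.YangMills.Theorems.BalabanUVNodesPortS1LocPowSeries
import Summits.QuantumFields.YangMills.Theorems.BalabanUVNodesK0RecordFormatNamesP0C

/-!
# NODE O port PT-A — OBJECTS OF THE v3.3 GLUE `stub_LZdetGlue` (27930, line `pta_residueW`), TORUS SIDE: the non-b₀ block of a carrier, the unit pair, and THE LOCALIZED PIECES OF THE GAUSSIAN
# BRACKET — `G_X(φ) := ½∫₀^R EG_X(x, φ) dx + powMemberPiece_X(φ)` (resolvent member from `stub_G3C`'s resummed pieces + the power members of [16] (63) localized by this seat's `…LocPow*` files) and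
# the unit-subtracted piece `E_X(φ) := G_X(φ) − G_X(𝟙)` («value at U_{k+1}(W_B) minus value at 1», [I] (2.12)∕(2.14)), bundled as `TorusPieces F Mc k`

Cell `ym-nodeO-ideate`, porter seat `ymgap-nodeO-port-PTA-1` (gen 7); DEFINITION file (objects the line posits), `--supports stmt-QuantumFields-27930`.  [16] = [Balaban1985UV3], [I] = [Balaban1987RG1].
Over DEF-1 ed.23 (`P0CarrierClauses`: carriers `TY n Y φ : FluctIdx → FluctIdx → ℂ`), this seat's ✓`…PortS1G3CDefs` (`EG x n X φ`) and ✓`…LocPowSeries` (`powMemberPiece`).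
* `nonB0Block F k K A` — the `NonB0Idx × NonB0Idx` block of a `FluctIdx`-kernel (the index of `recordPreckLoc`, (P2)).
* `unitCPair F K := (1, 0)` — the unit pair (the configuration of `B = 0` in the rooted gauge: `recordBgField_zero`, `recordCurrent_zero`).
* `lzdetGPiece F Mc k K TYK EGK R X φ` — the UNSUBTRACTED localized piece `½∫₀^R EGK x X φ dx + powMemberPiece (Y ↦ Y) (Y ↦ nonB0Block (TYK Y φ)) R X` at one volume `K`;
  `lzdetPiece … X φ := lzdetGPiece … X φ − lzdetGPiece … X (unitCPair F K)`; `lzdetTorusPieces F Mc k TY EG R : TorusPieces F Mc k` (the same at the volumes `recordK₀ F Mc k + n`).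

HONEST FRAMING.  Definitions only; NOTHING of Bałaban asserted or proved; whether these pieces satisfy the residue's rows is the content of the companion proof files (pointwise heart ✓`…LZdet63Local`);
`stub_P0C` ∕ `stub_G3C` ∕ `stub_LZdetGlue` ∕ `stub_FE` OPEN; 27930 OPEN (stubs 2∕6 by name) · no claim; NODE O 0∕1; COUNT 8∕28 · K 1∕4 UNMOVED; finite `𝕋⁴_{L^K}` at fixed ε — NOT continuum ∕ OS ∕ Clay;
**the Yang–Mills mass gap is NOT proved by any of this.**  No `sorry`, no `instance`, no `notation`; standard axioms.
-/

noncomputable section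

open scoped BigOperators Matrix.Norms.L2Operator

namespace Summit.QuantumFields.YangMills.Theorems.BalabanUVNodesPortS1

open Summit.QuantumFields.YangMills.Theorems.K0RecordFormatNames
open Literature.MathematicalPhysics.QuantumFieldTheory.Balaban1983to89
open Literature.MathematicalPhysics.QuantumFieldTheory.Balaban1983to89.Node00
open Literature.MathematicalPhysics.QuantumFieldTheory.Balaban1983to89.T4Continuum (T4Family)
open Literature.MathematicalPhysics.QuantumFieldTheory.Balaban1983to89.TreeLengthTorus (TPt)

/-- **The non-b₀ block** of a `FluctIdx`-indexed kernel: the `NonB0Idx × NonB0Idx` matrix (the index of DEF-1's `recordPreckLoc`; (P2) of the P0-ℂ letter identifies this block of `TC n φ_B` with it).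
[cite: Balaban1987RG1, (2.11)–(2.12) pp.267–268 («the variables B′(b), b ≠ b₀(c)»)] -/
def nonB0Block (F : T4Family) (k K : ℕ) (A : FluctIdx F k K → FluctIdx F k K → ℂ) : Matrix (NonB0Idx F k K) (NonB0Idx F k K) ℂ :=
  Matrix.of fun i j => A i.1 j.1

/-- **The unit pair** `(𝐔 ≡ 1, 𝐉 ≡ 0)` — the configuration of `B = 0` in the rooted gauge (`U_{k+1}(W_0) = 1`, its (1.8) current `0`). [cite: Balaban1987RG1, (2.3) p.265, (2.14) p.268] -/
def unitCPair (F : T4Family) (K : ℕ) : Sect2.CPair (F.P K) (MatA 2) := (fun _ => 1, fun _ => 0)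

open scoped Classical in
/-- ★ **THE UNSUBTRACTED LOCALIZED PIECE OF THE GAUSSIAN BRACKET at volume `K`**: `G_X(φ) := ½∫₀^R EG_X(x, φ) dx + powMemberPiece (Y ↦ Y) (Y ↦ nonB0Block (TY_Y φ)) R X` — the piece of `X` in
`½∫₀^R Tr (x + T(φ))⁻¹ dx + Σ_{n≥1} ((−1)ⁿ∕2n) R⁻ⁿ Tr T(φ)ⁿ = −½ log det T(φ) + ½·Tr 1·log R` ([16] (63) on `[0, R]`). [cite: Balaban1985UV3, (63) pp.271–272, (24)–(25) p.262; Balaban1987RG1, (1.7) p.261] -/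
def lzdetGPiece (F : T4Family) (Mc k K : ℕ)
    (TYK : (recordDomSys F Mc k K).Dom → Sect2.CPair (F.P K) (MatA 2) → FluctIdx F k K → FluctIdx F k K → ℂ)
    (EGK : ℝ → (recordDomSys F Mc k K).Dom → Sect2.CPair (F.P K) (MatA 2) → ℂ) (R : ℝ)
    (X : (recordDomSys F Mc k K).Dom) (φ : Sect2.CPair (F.P K) (MatA 2)) : ℂ :=
  (1 / 2 : ℂ) * (∫ x in (0 : ℝ)..R, EGK x X φ)
    + powMemberPiece (fun Y : (recordDomSys F Mc k K).Dom => (Y.1 : Finset (TPt (F.P K).d (Sect2.domCount (F.P K) Mc (k + 1)))))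
        (fun Y => nonB0Block F k K (TYK Y φ)) R X.1

/-- ★ **THE LOCALIZED PIECE OF THE GAUSSIAN BRACKET**: `E_X(φ) := G_X(φ) − G_X(𝟙)` (print's normalisation subtraction «log Z^{(k)}(U_{k+1}) − log Z^{(k)}(1)» piece by piece).
[cite: Balaban1987RG1, (2.12)–(2.14) p.268, (1.7) p.261; Balaban1985UV3, (61) p.271] -/
def lzdetPiece (F : T4Family) (Mc k K : ℕ)
    (TYK : (recordDomSys F Mc k K).Dom → Sect2.CPair (F.P K) (MatA 2) → FluctIdx F k K → FluctIdx F k K → ℂ)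
    (EGK : ℝ → (recordDomSys F Mc k K).Dom → Sect2.CPair (F.P K) (MatA 2) → ℂ) (R : ℝ)
    (X : (recordDomSys F Mc k K).Dom) (φ : Sect2.CPair (F.P K) (MatA 2)) : ℂ :=
  lzdetGPiece F Mc k K TYK EGK R X φ - lzdetGPiece F Mc k K TYK EGK R X (unitCPair F K)

/-- ★ **THE TORUS PIECES OF THE GAUSSIAN BRACKET at the volumes `recordK₀ F Mc k + n`**, in the type `TorusPieces F Mc k` of the wrap-aware residue (carriers `TY`, resummed resolvent pieces `EG`, radius `R`).
[cite: Balaban1987RG1, (1.7) p.261, (1.21) p.264; Balaban1985UV3, (63) p.272] -/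
def lzdetTorusPieces (F : T4Family) (Mc k : ℕ)
    (TY : (n : ℕ) → (recordDomSys F Mc k (recordK₀ F Mc k + n)).Dom → Sect2.CPair (F.P (recordK₀ F Mc k + n)) (MatA 2) →
        FluctIdx F k (recordK₀ F Mc k + n) → FluctIdx F k (recordK₀ F Mc k + n) → ℂ)
    (EG : ℝ → (n : ℕ) → (recordDomSys F Mc k (recordK₀ F Mc k + n)).Dom → Sect2.CPair (F.P (recordK₀ F Mc k + n)) (MatA 2) → ℂ) (R : ℝ) :
    TorusPieces F Mc k :=
  fun n X φ => lzdetPiece F Mc k (recordK₀ F Mc k + n) (TY n) (fun x => EG x n) R X φ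

end Summit.QuantumFields.YangMills.Theorems.BalabanUVNodesPortS1

end
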